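import Summits.ResolutionOfSingularities.ResolutionOfSingularities.Theorems.HeightCutCells
import Summits.ResolutionOfSingularities.ResolutionOfSingularities.Theorems.MaxContactCutKangarooCut
import Summits.ResolutionOfSingularities.ResolutionOfSingularities.Theorems.ContactFreeIsPPower
import HarnessLib

/-!
# MaxContactCutHeightCut — decomp-res node «HeightCut» (lens-4 g25, critic row 151), tree file 4/4 of the node

Content VERBATIM from the decomp-res lens-4 g25 node `HOME/decomp-res-lens-4/g25/HeightCut.lean` (pin 3caeb106, 1
322 l; HOME = run/shared/lean/pub/decomp-res):
its NEW PART ONLY, l. 815–1320 (§64, §64b, §65; 26 declarations) — the carried block l. 79–811 (= row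
148a's landing unit `KangarooCutTree` 76e53063,
machine diff empty) is ALREADY in the tree as `Theorems/PPowerSpan` · `KangarooTransport` · `KangarooTowers` ·
`KangarooCutCells` · `MaxContactCutKangarooCut`
and is DELETED ON LANDING as the lens instructs.  Critic: CRITIC-LEDGER row 151 (CLEARED 2026-08-30T22:50:05Z,
DECIDED +1 (i*) at p = 2 = n: the WEIGHT-TWO
HEIGHT LAW in kernel empties the principal double-point/dim-4 cell; exact re-location to
`NoWildKangarooOffDoublePointTowers`); landing orders INBOX :442/:444
(lens-4 g25) and :463 (critic): `HeightLaw` (§64) · `HeightTowers` (§64b) · `HeightCutCells` (§65), `--supports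
stmt-ResolutionOfSingularities-28338`.  Landed by
decomp-res writer g8 in the lens's namespace `…Theorems.HugValuationCut`, CONE-AWARE: `HeightLaw`, `HeightTowers`,
`HeightCutCells` are OUTSIDE the Theses
cone (importable by the route file); the two §65 up-links from the MaxContactCut item 31571
(`noWildPPowerOffLocusTowers_iff_g25 (h71)`,
`noWildContactFreeOffLocusTowers_iff_g25 (h71)`) are the in-cone wiring file `MaxContactCutHeightCut`.  Aside
bookkeeping (critic rows 148/151): the ONE
successor aside of the kangaroo column is filed directly as `NoWildKangarooOffDoublePointTowers` (home
`HeightCutCells`) SUPERSEDING 28338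
`LCNoWildContactFreeOffLocusTowers` — exactness chain `noWildContactFreeOffLocusTowers_iff_pPower` (tree, every
field) ∘ `noWildPPowerOffLocusTowers_iff_kangaroo
(h31571)` (tree, `MaxContactCutKangarooCut`) ∘ `noWildKangarooOffLocusTowers_iff_g25` (this node, hypothesis-free)
= `noWildContactFreeOffLocusTowers_iff_g25 (h71)`;
the decided cell `NoWildKangarooDoublePointTowers` is PROVED (`noWildKangarooDoublePointTowers_holds`) and is not filed.

§65, IN-CONE PART: the two up-links from the MaxContactCut item 31571 `MaxContactCut.NoContactHuggingTowers` BY NAME —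
`noWildPPowerOffLocusTowers_iff_g25 (h71)` (via the landed `noWildPPowerOffLocusTowers_iff_kangaroo`,
`MaxContactCutKangarooCut`) and
`noWildContactFreeOffLocusTowers_iff_g25 (h71) : NoWildContactFreeOffLocusTowers ↔
NoWildKangarooOffDoublePointTowers` (via lens-6's landed
`noWildContactFreeOffLocusTowers_iff_pPower`, `ContactFreeIsPPower`) = the exactness certificate of the aside
supersession 28338 ↦
`NoWildKangarooOffDoublePointTowers`.  INSIDE the Theses cone (wiring file; never imported by the route file).

[WRITER NOTE (decomp-res writer g8): section split only; namespace, universes, section variables and every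
declaration exactly as in the lens
(global `set_option` dropped; the lens's cone import `MaxContactCutTameCut` is replaced in the cone-free files by
the landed cone-free chain under
`KangarooCutCells` — `AbsoluteGiraudKernel` (`AbsoluteContactClasses.isRsopPart_one_of_not_mem_sq`,
`point_round_chart`), `…CentreSpread` (`centreSpread`),
`PPowerTowers`, `TameCutStage`, `LatencyCutCells`; the `open …Theses` line lives only in the wiring file).]

(Sources: Hauser2010Kangaroo; Moh1987; HauserPerlega2019; Hironaka1970Additive; CossartPiltant2008 §2;
CossartPiltant2019 Prop. 2.50; Kollar2007 Rem. 2.61.2; EGA IV₄ 16.11.2; StacksProject.)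
-/

noncomputable section

open CategoryTheory AlgebraicGeometry IsLocalRing
open Literature.AlgebraicGeometry.Resolution
open Summit.ResolutionOfSingularities.ResolutionOfSingularities.Theses
open Summit.ResolutionOfSingularities.ResolutionOfSingularities.Theorems
open WeakOrderReduction ForcedTowerClasses DivergentTowerClasses MonomialTowerClasses
open HugDimensionClasses HugDimensionKernels SurfaceShadowClasses SurfaceShadowKernels
open NearPointCut (SingularClass)
open AbsoluteContactClasses (IsAbsContactAt SepResidueAt diffIdeal_restrict_le stalkMap_comp_toStalk_eq_stalkHom)
open scoped BigOperators

namespace Summit.ResolutionOfSingularities.ResolutionOfSingularities.Theorems.HugValuationCut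

/-! ## §65 (g25 · CELLS) THE HEIGHT CUT of the kangaroo residual — EXACT, hypothesis-free

`WildKangarooOffLocusTowersTerminate n` (g24's located residual: singular-class, marked-shadow, `p`-power, NOT eventually
jump-free) splits by pure logic along `n = 2 ∧ DoublePointTower T`:
* `WildKangarooDoublePointTowersTerminate n` — DECIDED: PROVED for every `n` (`no_doublePointTower`; EMPTY BY THE HEIGHT LAW);
* `WildKangarooOffDoublePointTowersTerminate n` — THE LOCATED RESIDUAL after g25: recurrent `p`-power kangaroo
towers which, IF
  `n = 2`, never pass from a double point (principal mod `𝔪⁴`, weak contact) to a dim-4 point — over a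
perfect field at weight
  two: every stage with principal stalk is followed by a point of ring dimension ≤ 3 (`doublePointAt_stage_of_pPowerFormAt`),
  i.e. the weight-two tower is CONFINED TO THREEFOLD GERMS from its first principal stage on, or has non-principal stalks; and
  every weight `n ≥ 3` tower (the law is sharp there, §64 DELIMITERS).
By name: `NoWildKangarooOffLocusTowers ↔ NoWildKangarooOffDoublePointTowers` (`noWildKangarooOffLocusTowers_iff_g25`). -/

section HeightCells

variable {k : Type} [Field k]

/-- **GIVEN 31571 BY NAME: g23's `p`-power residual ⟺ the g25 residual** (g24 `noWildPPowerOffLocusTowers_iff_kangaroo` +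
`noWildKangarooOffLocusTowers_iff_g25`). [folklore] -/
theorem noWildPPowerOffLocusTowers_iff_g25 (h71 : MaxContactCut.NoContactHuggingTowers) :
    NoWildPPowerOffLocusTowers ↔ NoWildKangarooOffDoublePointTowers := by
  rw [noWildPPowerOffLocusTowers_iff_kangaroo h71, noWildKangarooOffLocusTowers_iff_g25]

/-- **GIVEN 31571 BY NAME, THE TREE ASIDE 28338 ⟺ THE g25 RESIDUAL** — `NoWildContactFreeOffLocusTowers` (tree aside) ⟺
`NoWildPPowerOffLocusTowers` by lens-6's landed `noWildContactFreeOffLocusTowers_iff_pPower` (`Theorems/ContactFreeIsPPower`,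
every field) ⟺ the off-double-point residual. [folklore] -/
theorem noWildContactFreeOffLocusTowers_iff_g25 (h71 : MaxContactCut.NoContactHuggingTowers) :
    NoWildContactFreeOffLocusTowers ↔ NoWildKangarooOffDoublePointTowers := by
  rw [noWildContactFreeOffLocusTowers_iff_pPower, noWildPPowerOffLocusTowers_iff_g25 h71]

end HeightCells

end Summit.ResolutionOfSingularities.ResolutionOfSingularities.Theorems.HugValuationCut
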